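import Literature.IUT.HodgeArakelov.MonoThetaCyclotomes
import Literature.AnabelianGeometry.EtaleTheta.ThetaRigidity
import Mathlib.GroupTheory.SpecificGroups.Cyclic

/-!
# Bridge B8, part 5a: the cyclotomes of the [EtTh] model mono-theta environment, from L2's `RigidData`

abc-iut cell, MERGE-MAP §1 gate «L2-t2 `ThetaRigidity` (p405849, `RigidData N l extends ThetaEnvData`) →
abc-iut-L6-t1 `CyclotomicRigidity` (`MonoThetaCyclotomes` p405104)», inside bridge **B8** (abc-iut-L6-d6).

[IUTchII] Def. 1.1 (i), (ii) (kurims pp. 20–21) attaches to a mono-theta environment `M` "a subquotient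
`(l·Δ_Θ)(M)` of `Π_Y(M)` which admits a natural `Π_X(M)`-action … abstractly isomorphic to `Ẑ(1)`", "a closed
normal subgroup `Π_μ(M) := Ker(Π_M ↠ Π_Y(M))` … abstractly isomorphic to `(ℤ/Nℤ)(1)`" and "a cyclotomic
rigidity isomorphism `(l·Δ_Θ)(M) ⊗ (ℤ/Nℤ) ≅ Π_μ(M)`" [cf. [EtTh] Cor. 2.19 (i)]. For the MODEL
`Π^tp_Y[μ_N] = μ_N ⋊ Π^tp_Y` of L2's interface `R : RigidData N l` ([EtTh] §2: `lDeltaTheta`/`thetaKer` = the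
inverse images in `Π^tp_X` of `l·Δ_Θ ⊆ (Δ^tp_X)^Θ`, `thetaMod : l·Δ_Θ ↠ μ_N` with kernel `thetaKer·(N-th powers)`,
`χ(aug ·)`-equivariant) this file CONSTRUCTS, by pure group theory:

* `SubquotientKit.*` — generic: a chain `B ≤ A ≤ Y` of subgroups of `P` (`A, B` normal in `P`) as one of
  t1's `Subquotient ↥Y`, its carrier identified with `↥A ⧸ (B ⊓ A)`, and the CONJUGATION ACTION
  `P →* MulAut` on it;
* `ModelCyclotomes.intCyc R : Subquotient ↥Π^tp_Y` — the interior cyclotome `(l·Δ_Θ)/thetaKer` of the model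
  with its `Π^tp_X`-action `intAct`;
* `ModelCyclotomes.intModEquiv R : ModPow (carrier) N ≃* μ_N` — "`(l·Δ_Θ) ⊗ ℤ/Nℤ ≅ μ_N`" induced by
  `thetaMod` (PROVED bijective from `thetaMod_surjective` / `thetaMod_ker`), `χ ∘ aug`-EQUIVARIANT
  (`intModEquiv_conj`);
* `ModelCyclotomes.muEquivKerProj R : μ_N ≃* Ker(Π^tp_Y[μ_N] ↠ Π^tp_Y)` — the exterior cyclotome of the
  model IS `μ_N`, on which `Π^tp_X` acts through `χ ∘ aug` (`conjX_inMu`).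

Part 5b (`ModelReconstruction`) assembles these into t1's `Reconstruction` / `CyclotomicRigidity` /
`Def11Output` for the model. HONEST FRAMING: bookkeeping over a refereed source's typed interface; nothing
disputed is asserted, no side taken on [IUTchIII] Cor. 3.12; typed ≠ discharged.
[cite: MochizukiEtTh2009, Cor 2.19(i) p.64]; [IUTchII] Def. 1.1 [claim: Mochizuki2012, status: disputed]
(IUTchII §1 Def 1.1, kurims pp.20-21).
-/

namespace Literature.IUT.HodgeArakelov

universe u

open Literature.AnabelianGeometry.EtaleTheta

/-! ## Generic: a chain of normal subgroups as a subquotient, and the conjugation action on it -/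

namespace SubquotientKit

variable {P : Type u} [Group P]

/-- `A/B`-type quotient `↥A ⧸ (B ⊓ A)` for subgroups `B, A` of `P` (`B` normal).
[claim: Mochizuki2012, status: disputed] (IUTchII §1 Def 1.1 (i), kurims p.21) -/
abbrev quot (A B : Subgroup P) [B.Normal] : Type u := ↥A ⧸ B.subgroupOf A

/-- The chain `B ≤ A ≤ Y` (with `B` normal in `P`) as a `Subquotient` of `↥Y` in the sense of
`Literature.IUT.HodgeArakelov.Subquotient` (top `:= A ∩ Y`, bot `:= B ∩ Y`).
[claim: Mochizuki2012, status: disputed] (IUTchII §1 Def 1.1 (i), kurims p.21) -/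
def ofChain (Y A B : Subgroup P) [B.Normal] (hBA : B ≤ A) : Subquotient ↥Y where
  top := A.subgroupOf Y
  bot := B.subgroupOf Y
  le := fun _ hy => hBA hy
  normal := inferInstance

/-- Conjugation by `P` on `↥A` maps `B ∩ A` onto itself (`A`, `B` normal).
[claim: Mochizuki2012, status: disputed] (IUTchII §1 Def 1.1 (i), kurims p.21) -/
theorem map_conjNormal_subgroupOf (A B : Subgroup P) [A.Normal] [B.Normal] (x : P) :
    (B.subgroupOf A).map ((MulAut.conjNormal x : MulAut ↥A) : ↥A →* ↥A) = B.subgroupOf A := by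
  have key : ∀ (y : P), (B.subgroupOf A).map ((MulAut.conjNormal y : MulAut ↥A) : ↥A →* ↥A) ≤
      B.subgroupOf A := by
    intro y
    rintro _ ⟨b, hb, rfl⟩
    have hb' : (b : P) ∈ B := hb
    show ((MulAut.conjNormal y b : ↥A) : P) ∈ B
    rw [MulAut.conjNormal_apply]
    exact ‹B.Normal›.conj_mem _ hb' y
  refine le_antisymm (key x) fun b hb => ?_
  refine ⟨MulAut.conjNormal x⁻¹ b, key x⁻¹ ⟨b, hb, rfl⟩, ?_⟩
  rw [MonoidHom.coe_coe, ← MulAut.mul_apply, ← map_mul, mul_inv_cancel, map_one, MulAut.one_apply]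

/-- The **conjugation action** of `P` on `↥A ⧸ (B ∩ A)` (`B ≤ A` normal subgroups of `P`), as a homomorphism
`P →* MulAut`. [claim: Mochizuki2012, status: disputed] (IUTchII §1 Def 1.1 (i), kurims p.21) -/
noncomputable def conjQuot (A B : Subgroup P) [A.Normal] [B.Normal] : P →* MulAut (quot A B) where
  toFun x := QuotientGroup.congr (B.subgroupOf A) (B.subgroupOf A) (MulAut.conjNormal x)
    (map_conjNormal_subgroupOf A B x)
  map_one' := by
    apply MulEquiv.ext
    intro q
    induction q using QuotientGroup.induction_on with
    | H a =>
      rw [QuotientGroup.congr_mk, map_one, MulAut.one_apply, MulAut.one_apply]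
  map_mul' x y := by
    apply MulEquiv.ext
    intro q
    induction q using QuotientGroup.induction_on with
    | H a =>
      rw [MulAut.mul_apply, QuotientGroup.congr_mk, QuotientGroup.congr_mk, QuotientGroup.congr_mk,
        map_mul, MulAut.mul_apply]

/-- `conjQuot` on classes: `x · [a] = [x a x⁻¹]`. [claim: Mochizuki2012, status: disputed] (IUTchII §1 Def 1.1 (i), kurims p.21) -/
@[simp] theorem conjQuot_mk (A B : Subgroup P) [A.Normal] [B.Normal] (x : P) (a : ↥A) :
    conjQuot A B x (a : quot A B) = (MulAut.conjNormal x a : quot A B) :=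
  QuotientGroup.congr_mk (B.subgroupOf A) (B.subgroupOf A) (MulAut.conjNormal x)
    (map_conjNormal_subgroupOf A B x) a

/-- The carrier of `ofChain Y A B` (t1's `top ⧸ bot ⊓ top` inside `↥Y`) identified with `↥A ⧸ (B ∩ A)`, for
`A ≤ Y`. [claim: Mochizuki2012, status: disputed] (IUTchII §1 Def 1.1 (i), kurims p.21) -/
noncomputable def carrierEquiv (Y A B : Subgroup P) [B.Normal] (hBA : B ≤ A) (hAY : A ≤ Y) :
    (ofChain Y A B hBA).carrier ≃* quot A B :=
  QuotientGroup.congr _ _ (Subgroup.subgroupOfEquivOfLe hAY) (by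
    ext a
    constructor
    · rintro ⟨b, hb, rfl⟩
      exact hb
    · intro ha
      exact ⟨(Subgroup.subgroupOfEquivOfLe hAY).symm a, ha, MulEquiv.apply_symm_apply _ a⟩)

/-- `carrierEquiv` on classes is the identity on underlying elements of `P`.
[claim: Mochizuki2012, status: disputed] (IUTchII §1 Def 1.1 (i), kurims p.21) -/
theorem carrierEquiv_mk (Y A B : Subgroup P) [B.Normal] (hBA : B ≤ A) (hAY : A ≤ Y)
    (a : ↥((ofChain Y A B hBA).top)) :
    carrierEquiv Y A B hBA hAY (a : (ofChain Y A B hBA).carrier) =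
      ((Subgroup.subgroupOfEquivOfLe hAY a : ↥A) : quot A B) :=
  QuotientGroup.congr_mk _ _ _ _ a

/-- The conjugation action of `P` on the carrier of `ofChain Y A B` (transported along `carrierEquiv`).
[claim: Mochizuki2012, status: disputed] (IUTchII §1 Def 1.1 (i), kurims p.21) -/
noncomputable def conjCarrier (Y A B : Subgroup P) [A.Normal] [B.Normal] (hBA : B ≤ A) (hAY : A ≤ Y) :
    P →* MulAut (ofChain Y A B hBA).carrier :=
  (MulAut.congr (carrierEquiv Y A B hBA hAY).symm).toMonoidHom.comp (conjQuot A B)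

/-- `conjCarrier` in terms of `conjQuot`: `carrierEquiv (x · c) = x · carrierEquiv c`.
[claim: Mochizuki2012, status: disputed] (IUTchII §1 Def 1.1 (i), kurims p.21) -/
theorem carrierEquiv_conjCarrier (Y A B : Subgroup P) [A.Normal] [B.Normal] (hBA : B ≤ A) (hAY : A ≤ Y)
    (x : P) (c : (ofChain Y A B hBA).carrier) :
    carrierEquiv Y A B hBA hAY (conjCarrier Y A B hBA hAY x c) =
      conjQuot A B x (carrierEquiv Y A B hBA hAY c) := by
  change carrierEquiv Y A B hBA hAY ((carrierEquiv Y A B hBA hAY).symm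
    (conjQuot A B x ((carrierEquiv Y A B hBA hAY).symm.symm c))) = _
  rw [MulEquiv.apply_symm_apply, MulEquiv.symm_symm]

end SubquotientKit

/-! ## The cyclotomes of the model `Π^tp_Y[μ_N]` of `R : RigidData N l` -/

namespace ModelCyclotomes

variable {N : ℕ+} {l : ℕ} (R : RigidData.{u} N l)

/-- `l·Δ_Θ` (its inverse image) is normal in `Π^tp_X` (L2's axiom, as an instance for the quotient API).
[cite: MochizukiEtTh2009, Prop 2.12 p.45] -/
instance lDeltaTheta_normal : R.lDeltaTheta.Normal := R.lDeltaTheta_normal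

/-- `Ker(Π^tp_X ↠ (Π^tp_X)^Θ)` is normal in `Π^tp_X` (L2's axiom, as an instance).
[cite: MochizukiEtTh2009, Prop 2.12 p.45] -/
instance thetaKer_normal : R.thetaKer.Normal := R.thetaKer_normal

/-- `l·Δ_Θ ⊆ Π^tp_Y` (indeed `⊆ Δ^tp_Ÿ`). [cite: MochizukiEtTh2009, Prop 2.14(i) p.49] -/
theorem lDeltaTheta_le_PiY : R.lDeltaTheta ≤ R.PiY :=
  fun _ hx => R.PiYdd_le (R.lDeltaTheta_le hx).1

/-- **The interior cyclotome of the model**, `(l·Δ_Θ)(M) = (l·Δ_Θ)/thetaKer` as a subquotient of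
`Π_Y(M) = Π^tp_Y` ([IUTchII] Def. 1.1 (i) "a subquotient `(l·Δ_Θ)(M)` of `Π_Y(M)`").
[claim: Mochizuki2012, status: disputed] (IUTchII §1 Def 1.1 (i), kurims p.21) -/
def intCyc : Subquotient ↥R.PiY :=
  SubquotientKit.ofChain R.PiY R.lDeltaTheta R.thetaKer R.thetaKer_le_lDeltaTheta

/-- `(l·Δ_Θ)/thetaKer` as a plain quotient group. [cite: MochizukiEtTh2009, Cor 2.19(i) p.64] -/
abbrev lDeltaQuot : Type u := SubquotientKit.quot R.lDeltaTheta R.thetaKer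

/-- The carrier of the interior cyclotome identified with `(l·Δ_Θ)/thetaKer`.
[claim: Mochizuki2012, status: disputed] (IUTchII §1 Def 1.1 (i), kurims p.21) -/
noncomputable def intCycEquiv : (intCyc R).carrier ≃* lDeltaQuot R :=
  SubquotientKit.carrierEquiv R.PiY R.lDeltaTheta R.thetaKer R.thetaKer_le_lDeltaTheta
    (lDeltaTheta_le_PiY R)

/-- **The natural `Π_X(M) = Π^tp_X`-action on the interior cyclotome** (conjugation; `l·Δ_Θ` and `thetaKer`
are normal in `Π^tp_X`). [claim: Mochizuki2012, status: disputed] (IUTchII §1 Def 1.1 (i), kurims p.21) -/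
noncomputable def intAct : R.PiX →* MulAut (intCyc R).carrier :=
  SubquotientKit.conjCarrier R.PiY R.lDeltaTheta R.thetaKer R.thetaKer_le_lDeltaTheta
    (lDeltaTheta_le_PiY R)

/-- `thetaMod : l·Δ_Θ ↠ μ_N` kills `thetaKer`. [cite: MochizukiEtTh2009, Cor 2.19(i) p.64] -/
theorem thetaMod_eq_one_of_mem_thetaKer (g : ↥R.lDeltaTheta) (hg : (g : R.PiX) ∈ R.thetaKer) :
    R.thetaMod g = 1 :=
  (R.thetaMod_ker g).2 ⟨g, hg, 1, by simp⟩

/-- `thetaMod` descended to `(l·Δ_Θ)/thetaKer → μ_N`. [cite: MochizukiEtTh2009, Cor 2.19(i) p.64] -/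
noncomputable def thetaModQuot : lDeltaQuot R →* R.mu :=
  QuotientGroup.lift _ R.thetaMod fun g hg => by
    rw [MonoidHom.mem_ker]
    exact thetaMod_eq_one_of_mem_thetaKer R g hg

/-- `thetaModQuot` on classes. [cite: MochizukiEtTh2009, Cor 2.19(i) p.64] -/
@[simp] theorem thetaModQuot_mk (g : ↥R.lDeltaTheta) :
    thetaModQuot R (g : lDeltaQuot R) = R.thetaMod g := rfl

/-- `thetaModQuot` is onto `μ_N`. [cite: MochizukiEtTh2009, Cor 2.19(i) p.64] -/
theorem thetaModQuot_surjective : Function.Surjective (thetaModQuot R) := fun a => by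
  obtain ⟨g, rfl⟩ := R.thetaMod_surjective a
  exact ⟨g, rfl⟩

/-- `μ_N` has `Nat.card = N`. [cite: MochizukiEtTh2009, Def 2.13 p.47] -/
theorem natCard_mu : Nat.card R.mu = N := by
  rw [Nat.card_eq_fintype_card, R.card_mu]

/-- Every element of `μ_N` has `N`-th power `1`. [cite: MochizukiEtTh2009, Def 2.13 p.47] -/
theorem pow_N_eq_one (a : R.mu) : a ^ (N : ℕ) = 1 := by
  rw [← natCard_mu R]
  exact pow_card_eq_one'

/-- `thetaModQuot` kills `N`-th powers, hence descends to the mod-`N` reduction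
`ModPow ((l·Δ_Θ)/thetaKer) N → μ_N`. [cite: MochizukiEtTh2009, Cor 2.19(i) p.64] -/
noncomputable def thetaModPow : ModPow (lDeltaQuot R) (N : ℕ) →* R.mu :=
  QuotientGroup.lift _ (thetaModQuot R) (Subgroup.normalClosure_le_normal (by
    rintro _ ⟨q, rfl⟩
    rw [SetLike.mem_coe, MonoidHom.mem_ker, map_pow]
    exact pow_N_eq_one R _))

/-- `thetaModPow` on classes of classes. [cite: MochizukiEtTh2009, Cor 2.19(i) p.64] -/
@[simp] theorem thetaModPow_mk (q : lDeltaQuot R) :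
    thetaModPow R (q : ModPow (lDeltaQuot R) (N : ℕ)) = thetaModQuot R q := rfl

/-- `thetaModPow` is onto. [cite: MochizukiEtTh2009, Cor 2.19(i) p.64] -/
theorem thetaModPow_surjective : Function.Surjective (thetaModPow R) := fun a => by
  obtain ⟨q, rfl⟩ := thetaModQuot_surjective R a
  exact ⟨q, rfl⟩

/-- `thetaModPow` is injective: the kernel of `thetaMod` is `thetaKer · (N-th powers)` (L2's axiom
`thetaMod_ker`, i.e. `l·Δ_Θ/thetaKer ≅ Ẑ(1)` is torsion-free procyclic with `⊗ ℤ/Nℤ ≅ μ_N`).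
[cite: MochizukiEtTh2009, Cor 2.19(i) p.64] -/
theorem thetaModPow_injective : Function.Injective (thetaModPow R) := by
  rw [injective_iff_map_eq_one]
  intro c hc
  induction c using QuotientGroup.induction_on with
  | H q =>
    induction q using QuotientGroup.induction_on with
    | H g =>
      rw [thetaModPow_mk, thetaModQuot_mk] at hc
      obtain ⟨k, hk, h, hgkh⟩ := (R.thetaMod_ker g).1 hc
      rw [QuotientGroup.eq_one_iff]
      have hkA : k ∈ R.lDeltaTheta := R.thetaKer_le_lDeltaTheta hk
      have hg : g = ⟨k, hkA⟩ * h ^ (N : ℕ) := Subtype.ext (by simpa using hgkh)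
      have hq : ((g : ↥R.lDeltaTheta) : lDeltaQuot R) = ((h : lDeltaQuot R)) ^ (N : ℕ) := by
        rw [hg, QuotientGroup.mk_mul, QuotientGroup.mk_pow]
        have hk1 : ((⟨k, hkA⟩ : ↥R.lDeltaTheta) : lDeltaQuot R) = 1 := by
          rw [QuotientGroup.eq_one_iff, Subgroup.mem_subgroupOf]
          exact hk
        rw [hk1, one_mul]
      rw [hq]
      exact Subgroup.subset_normalClosure ⟨(h : lDeltaQuot R), rfl⟩

/-- **"`(l·Δ_Θ) ⊗ ℤ/Nℤ ≅ μ_N`" for the model**: the mod-`N` reduction of the interior cyclotome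
`(l·Δ_Θ)/thetaKer` is isomorphic to `μ_N` via `thetaMod` ([EtTh] Cor. 2.19 (i): "the natural isomorphism
of cyclotomes determined by `s^alg`, `s^Θ`", cf. L2's `cocycle_lDeltaTheta`).
[cite: MochizukiEtTh2009, Cor 2.19(i) p.64] -/
noncomputable def lDeltaModEquiv : ModPow (lDeltaQuot R) (N : ℕ) ≃* R.mu :=
  MulEquiv.ofBijective (thetaModPow R) ⟨thetaModPow_injective R, thetaModPow_surjective R⟩

/-- `lDeltaModEquiv` on classes. [cite: MochizukiEtTh2009, Cor 2.19(i) p.64] -/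
@[simp] theorem lDeltaModEquiv_mk_mk (g : ↥R.lDeltaTheta) :
    lDeltaModEquiv R (((g : lDeltaQuot R)) : ModPow (lDeltaQuot R) (N : ℕ)) = R.thetaMod g := rfl

/-- Mod-`N` reduction is functorial: a group isomorphism induces one on `ModPow`.
[claim: Mochizuki2012, status: disputed] (IUTchII §1 Def 1.1 (ii), kurims p.21) -/
noncomputable def modPowCongr {A B : Type u} [Group A] [Group B] (e : A ≃* B) (n : ℕ) :
    ModPow A n ≃* ModPow B n :=
  QuotientGroup.congr _ _ e (by
    rw [Subgroup.map_normalClosure _ _ e.surjective]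
    congr 1
    ext b
    constructor
    · rintro ⟨_, ⟨a, rfl⟩, rfl⟩
      exact ⟨e a, by rw [MonoidHom.coe_coe, map_pow]⟩
    · rintro ⟨b, rfl⟩
      exact ⟨e.symm b ^ n, ⟨e.symm b, rfl⟩, by rw [MonoidHom.coe_coe, map_pow, MulEquiv.apply_symm_apply]⟩)

/-- `modPowCongr` on classes. [claim: Mochizuki2012, status: disputed] (IUTchII §1 Def 1.1 (ii), kurims p.21) -/
@[simp] theorem modPowCongr_mk {A B : Type u} [Group A] [Group B] (e : A ≃* B) (n : ℕ) (a : A) :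
    modPowCongr e n (a : ModPow A n) = (e a : ModPow B n) :=
  QuotientGroup.congr_mk _ _ _ _ a

/-- **The interior side of the rigidity isomorphism for the model**:
`ModPow ((l·Δ_Θ)(M)) N ≃* μ_N` on t1's carrier. [cite: MochizukiEtTh2009, Cor 2.19(i) p.64] -/
noncomputable def intModEquiv : ModPow (intCyc R).carrier (N : ℕ) ≃* R.mu :=
  (modPowCongr (intCycEquiv R) (N : ℕ)).trans (lDeltaModEquiv R)

/-- `thetaModQuot` is `χ ∘ aug`-equivariant for the conjugation action (L2's axiom `thetaMod_conj`).
[cite: MochizukiEtTh2009, Cor 2.19(i) p.64] -/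
theorem thetaModQuot_conjQuot (x : R.PiX) (q : lDeltaQuot R) :
    thetaModQuot R (SubquotientKit.conjQuot R.lDeltaTheta R.thetaKer x q) = R.chi (R.aug x) (thetaModQuot R q) := by
  induction q using QuotientGroup.induction_on with
  | H g =>
    rw [SubquotientKit.conjQuot_mk, thetaModQuot_mk, thetaModQuot_mk]
    exact R.thetaMod_conj x g

/-- The identification `intCycEquiv` intertwines `intAct` with the conjugation action on
`(l·Δ_Θ)/thetaKer`. [claim: Mochizuki2012, status: disputed] (IUTchII §1 Def 1.1 (i), kurims p.21) -/
theorem intCycEquiv_intAct (x : R.PiX) (c : (intCyc R).carrier) :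
    intCycEquiv R (intAct R x c) = SubquotientKit.conjQuot R.lDeltaTheta R.thetaKer x (intCycEquiv R c) :=
  SubquotientKit.carrierEquiv_conjCarrier R.PiY R.lDeltaTheta R.thetaKer R.thetaKer_le_lDeltaTheta
    (lDeltaTheta_le_PiY R) x c

/-- **Equivariance of the interior side**: `intModEquiv (x · c) = χ(aug x) · intModEquiv c` for the
`Π^tp_X`-action on the interior cyclotome and the cyclotomic character on `μ_N`.
[cite: MochizukiEtTh2009, Cor 2.19(i) p.64] -/
theorem intModEquiv_conj (x : R.PiX) (c : (intCyc R).carrier) :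
    intModEquiv R ((intAct R x c : (intCyc R).carrier) : ModPow (intCyc R).carrier (N : ℕ)) =
      R.chi (R.aug x) (intModEquiv R (c : ModPow (intCyc R).carrier (N : ℕ))) := by
  unfold intModEquiv
  rw [MulEquiv.trans_apply, MulEquiv.trans_apply, modPowCongr_mk, modPowCongr_mk, intCycEquiv_intAct]
  generalize intCycEquiv R c = q
  induction q using QuotientGroup.induction_on with
  | H g =>
    rw [SubquotientKit.conjQuot_mk, lDeltaModEquiv_mk_mk, lDeltaModEquiv_mk_mk]
    exact R.thetaMod_conj x g

/-! ## The exterior cyclotome of the model: `Ker(Π^tp_Y[μ_N] ↠ Π^tp_Y) = μ_N` -/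

/-- **The exterior cyclotome of the model IS `μ_N`**: `μ_N ≃* Ker(Π^tp_Y[μ_N] ↠ Π^tp_Y)` via `inMu`
(the semidirect-product kernel). [claim: Mochizuki2012, status: disputed] (IUTchII §1 Def 1.1 (i), kurims p.21) -/
noncomputable def muEquivKerProj : R.mu ≃* (CycEnvelope.proj R.augY R.chi).ker :=
  (MonoidHom.ofInjective (f := CycEnvelope.inMu R.augY R.chi) SemidirectProduct.inl_injective).trans
    (MulEquiv.subgroupCongr SemidirectProduct.range_inl_eq_ker_rightHom)

/-- `muEquivKerProj` on elements is `inMu`. [claim: Mochizuki2012, status: disputed] (IUTchII §1 Def 1.1 (i), kurims p.21) -/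
@[simp] theorem coe_muEquivKerProj (a : R.mu) :
    ((muEquivKerProj R a : (CycEnvelope.proj R.augY R.chi).ker) : R.env) = CycEnvelope.inMu R.augY R.chi a :=
  rfl

/-- Conjugation by `Π^tp_X` (`conjX`) acts on `μ_N ⊆ Π^tp_Y[μ_N]` through the cyclotomic character:
`conjX x (inMu a) = inMu (χ(aug x) a)`. [cite: MochizukiEtTh2009, Def 2.13(i) p.47] -/
theorem conjX_inMu (x : R.PiX) (a : R.mu) :
    R.conjX x (CycEnvelope.inMu R.augY R.chi a) = CycEnvelope.inMu R.augY R.chi (R.chi (R.aug x) a) := by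
  ext
  · rfl
  · change x * ((1 : ↥R.PiY) : R.PiX) * x⁻¹ = ((1 : ↥R.PiY) : R.PiX)
    simp

/-- `Π^tp_X` surjects onto `G_K` already from `Π^tp_Y` (indeed from `Π^tp_Ÿ`, L2's `augYdd_surjective`):
the printed "`(l·ℤ)(M) := Π_X(M)/Π_Y(M) ≅ Δ_X(M)/Δ_Y(M)`". [claim: Mochizuki2012, status: disputed] (IUTchII §1 Def 1.1 (i), kurims p.21) -/
theorem augY_surjective : Function.Surjective R.augY := fun g => by
  obtain ⟨y, hy⟩ := R.augYdd_surjective g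
  exact ⟨R.inclYdd y, hy⟩

end ModelCyclotomes

end Literature.IUT.HodgeArakelov
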